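import Literature.NumberTheory.DiophantineGeometry.AbcShapeCount
import HarnessLib

/-!
# Moments of the shape counts: coincidences, energies, and Cauchy–Schwarz

Combinatorial skeleton of the "Fourier analysis bound" for `B_d(c; X, Y, Z)`
([Bernert2025, Prop. 3], [BernertEtAl2024, Prop. 3.1]): with `U = (c₁ ∏ xᵢ^{i+1})_{x ∈ box X}`,
`V`, `W` the three value families,

* `B_d ≤ N(U, V, W) = #{(x, y, z) : u(x) + v(y) = w(z)}` (`shapeCount_le_tripleCount`);
* `N(U,V,W)² ≤ E(U,V) · E₂(W)` and `E(U,V)² ≤ E₄(U) · E₄(V)` (`tripleCount_sq_le`,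
  `mixedEnergy_sq_le`), where `E₂(W) = #{w(z) = w(z')}`, `E(U,V) = #{u + v = u' + v'}`,
  `E₄(U) = E(U,U)` — both by one abstract Cauchy–Schwarz inequality for coincidence counts,
  `coinc_sq_le : #{vP p = vQ q}² ≤ #{vP p = vP p'} · #{vQ q = vQ q'}`. These replace
  `∫ S₁S₂S̄₃ ≤ (∫|S₁|²)^{1/2}(∫|S₂|²|S₃|²)^{1/2}` and Hölder in the source (orthogonality turns
  each integral into exactly such a count);
* the second-moment ("Parseval + divisor bound") estimate `E₂(W) ≤ #box · D^d` whenever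
  `τ(∏ zᵢ^{i+1}) ≤ D` on the box (`energy2_le`, via `card_filter_shapeVal_eq_le`: a tuple with
  `∏ zᵢ^{i+1} = m` has all `zᵢ ∣ m`).

The fourth-moment bound `E₄ ≪ #box³ D^d / X_j` (the Fourier-positivity step) and the resulting
bound for `B_d` are in `AbcShapeFourthMoment` / `AbcShapeFourierBound`. Theorems 1.2/1.3 of
[BernertEtAl2024] (named facts of `AbcExceptionalSetBounds`) are NOT proved here.

## References

* [Bernert2025] C. Bernert, *The exceptional set in the abc conjecture*, arXiv:2506.13364 (2025),
  Proposition 3 and its proof ((3.1), (3.2)).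
* [BernertEtAl2024] C. Bernert, T. Browning, J. D. Lichtman, J. Teräväinen, *Bounds on the
  exceptional set in the abc conjecture*, arXiv:2410.12234, Proposition 3.1 (v1).
-/

noncomputable section

open Finset

namespace Literature.NumberTheory.DiophantineGeometry

namespace AbcShapes

/-! ### Coincidence counts and the Cauchy–Schwarz inequality -/

section coincidence

variable {P Q V : Type*} [DecidableEq V]

/-- The number of coincidences `#{(p, q) ∈ s_P × s_Q : v_P p = v_Q q}`. [folklore] -/
def coinc (sP : Finset P) (sQ : Finset Q) (vP : P → V) (vQ : Q → V) : ℕ :=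
  ((sP ×ˢ sQ).filter (fun t => vP t.1 = vQ t.2)).card

/-- Fibring coincidences over the common value. [folklore] -/
theorem coinc_eq_sum (sP : Finset P) (sQ : Finset Q) (vP : P → V) (vQ : Q → V) (S : Finset V)
    (hS : ∀ p ∈ sP, vP p ∈ S) :
    coinc sP sQ vP vQ =
      ∑ n ∈ S, (sP.filter (fun p => vP p = n)).card * (sQ.filter (fun q => vQ q = n)).card := by
  classical
  unfold coinc
  rw [card_eq_sum_card_fiberwise (f := fun t : P × Q => vP t.1) (t := S) (fun t ht => by
      obtain ⟨h, -⟩ := mem_filter.mp (mem_coe.mp ht)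
      exact mem_coe.mpr (hS _ (mem_product.mp h).1))]
  refine sum_congr rfl fun n _ => ?_
  rw [← card_product]
  congr 1
  ext ⟨p, q⟩
  simp only [mem_filter, mem_product]
  constructor
  · rintro ⟨⟨⟨hp, hq⟩, heq⟩, hn⟩
    exact ⟨⟨hp, hn⟩, hq, by rw [← heq, hn]⟩
  · rintro ⟨⟨hp, hn⟩, hq, hn'⟩
    exact ⟨⟨⟨hp, hq⟩, by rw [hn, hn']⟩, hn⟩

/-- **Cauchy–Schwarz for coincidences**: `#{v_P p = v_Q q}² ≤ #{v_P p = v_P p'} · #{v_Q q = v_Q q'}`.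
[folklore] -/
theorem coinc_sq_le (sP : Finset P) (sQ : Finset Q) (vP : P → V) (vQ : Q → V) :
    coinc sP sQ vP vQ ^ 2 ≤ coinc sP sP vP vP * coinc sQ sQ vQ vQ := by
  classical
  set S := sP.image vP ∪ sQ.image vQ with hS
  have hP : ∀ p ∈ sP, vP p ∈ S := fun p hp => mem_union_left _ (mem_image_of_mem _ hp)
  have hQ : ∀ q ∈ sQ, vQ q ∈ S := fun q hq => mem_union_right _ (mem_image_of_mem _ hq)
  rw [coinc_eq_sum sP sQ vP vQ S hP, coinc_eq_sum sP sP vP vP S hP, coinc_eq_sum sQ sQ vQ vQ S hQ]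
  simp_rw [← sq]
  exact sum_mul_sq_le_sq_mul_sq S _ _

/-- Coincidence counts are monotone under injective re-indexing into another coincidence set:
a convenient form of `card_le_card_of_injOn`. [folklore] -/
theorem coinc_le_coinc_of_injOn {P' Q' : Type*} {sP : Finset P} {sQ : Finset Q} {vP : P → V}
    {vQ : Q → V} {sP' : Finset P'} {sQ' : Finset Q'} {vP' : P' → V} {vQ' : Q' → V}
    (f : P × Q → P' × Q')
    (hf : ∀ t ∈ sP ×ˢ sQ, vP t.1 = vQ t.2 → f t ∈ sP' ×ˢ sQ' ∧ vP' (f t).1 = vQ' (f t).2)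
    (hinj : Set.InjOn f ↑(sP ×ˢ sQ)) :
    coinc sP sQ vP vQ ≤ coinc sP' sQ' vP' vQ' := by
  classical
  unfold coinc
  refine card_le_card_of_injOn f (fun t ht => ?_) (hinj.mono fun t ht => ?_)
  · obtain ⟨h1, h2⟩ := mem_filter.mp (mem_coe.mp ht)
    exact mem_coe.mpr (mem_filter.mpr (hf t h1 h2))
  · exact mem_coe.mpr (mem_filter.mp (mem_coe.mp ht)).1

end coincidence

/-! ### Values, the triple count and the energies -/

/-- The value `c · ∏ xᵢ^{i+1}` of a shape tuple, as an integer. [cite: Bernert2025, Proposition 3] -/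
def vals (c : ℕ) {d : ℕ} (x : Fin d → ℕ) : ℤ :=
  (c * shapeVal x : ℕ)

/-- `N(U, V, W) = #{(x, y, z) : c₁ V(x) + c₂ V(y) = c₃ V(z)}` (the count `B_d` without its gcd
condition), written as a coincidence count between `(x, y) ↦ u + v` and `z ↦ w`.
[cite: Bernert2025, Proposition 3] -/
def tripleCount {d : ℕ} (c₁ c₂ c₃ : ℕ) (X Y Z : Fin d → ℕ) : ℕ :=
  coinc (dyadicBox X ×ˢ dyadicBox Y) (dyadicBox Z) (fun p => vals c₁ p.1 + vals c₂ p.2) (vals c₃)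

/-- The mixed additive energy `E(U, V) = #{(x, y, x', y') : u(x) + v(y) = u(x') + v(y')}`.
[cite: Bernert2025, Proposition 3] -/
def mixedEnergy {d : ℕ} (c₁ : ℕ) (X : Fin d → ℕ) (c₂ : ℕ) (Y : Fin d → ℕ) : ℕ :=
  coinc (dyadicBox X ×ˢ dyadicBox Y) (dyadicBox X ×ˢ dyadicBox Y)
    (fun p => vals c₁ p.1 + vals c₂ p.2) (fun p => vals c₁ p.1 + vals c₂ p.2)

/-- The second moment `E₂(W) = #{(z, z') : w(z) = w(z')}` ("Parseval" count).
[cite: Bernert2025, Proposition 3] -/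
def energy2 {d : ℕ} (c : ℕ) (X : Fin d → ℕ) : ℕ :=
  coinc (dyadicBox X) (dyadicBox X) (vals c) (vals c)

/-- The fourth moment / additive energy `E₄(U) = #{u₁ + u₂ = u₃ + u₄} = E(U, U)`.
[cite: Bernert2025, Proposition 3] -/
def energy4 {d : ℕ} (c : ℕ) (X : Fin d → ℕ) : ℕ :=
  mixedEnergy c X c X

/-- `B_d ≤ N(U, V, W)` (drop the gcd condition). [cite: Bernert2025, Proposition 3] -/
theorem shapeCount_le_tripleCount {d : ℕ} (c₁ c₂ c₃ : ℕ) (X Y Z : Fin d → ℕ) :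
    shapeCount c₁ c₂ c₃ X Y Z ≤ tripleCount c₁ c₂ c₃ X Y Z := by
  classical
  rw [shapeCount, tripleCount, coinc]
  refine card_le_card_of_injOn (fun t => ((t.1, t.2.1), t.2.2)) (fun t ht => ?_)
    (fun t _ t' _ h => ?_)
  · obtain ⟨hbox, heq, -⟩ := mem_filter.mp (mem_coe.mp ht)
    simp only [mem_product] at hbox
    refine mem_coe.mpr (mem_filter.mpr ⟨?_, ?_⟩)
    · simp only [mem_product]; exact ⟨⟨hbox.1, hbox.2.1⟩, hbox.2.2⟩
    · simp only [vals]; exact_mod_cast heq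
  · simp only [Prod.mk.injEq] at h
    exact Prod.ext h.1.1 (Prod.ext h.1.2 h.2)

/-- **`N(U, V, W)² ≤ E(U, V) · E₂(W)`** (Cauchy–Schwarz over the common value `n = u + v = w`).
[cite: Bernert2025, Proposition 3] -/
theorem tripleCount_sq_le {d : ℕ} (c₁ c₂ c₃ : ℕ) (X Y Z : Fin d → ℕ) :
    tripleCount c₁ c₂ c₃ X Y Z ^ 2 ≤ mixedEnergy c₁ X c₂ Y * energy2 c₃ Z :=
  coinc_sq_le _ _ _ _

/-- **`E(U, V)² ≤ E₄(U) · E₄(V)`**: rewrite `u + v = u' + v'` as the coincidence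
`u - u' = v' - v` and apply Cauchy–Schwarz; the self-coincidences `u₁ - u₂ = u₃ - u₄` are the
additive quadruples `u₁ + u₄ = u₃ + u₂`. [cite: Bernert2025, Proposition 3] -/
theorem mixedEnergy_sq_le {d : ℕ} (c₁ c₂ : ℕ) (X Y : Fin d → ℕ) :
    mixedEnergy c₁ X c₂ Y ^ 2 ≤ energy4 c₁ X * energy4 c₂ Y := by
  classical
  -- `E(U,V)` as coincidences between differences
  set BX := dyadicBox X with hBX
  set BY := dyadicBox Y with hBY
  have h1 : mixedEnergy c₁ X c₂ Y ≤ coinc (BX ×ˢ BX) (BY ×ˢ BY)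
      (fun p => vals c₁ p.1 - vals c₁ p.2) (fun p => vals c₂ p.2 - vals c₂ p.1) := by
    refine coinc_le_coinc_of_injOn (fun t => ((t.1.1, t.2.1), (t.1.2, t.2.2)))
      ?_ (fun t _ t' _ h => ?_)
    · rintro ⟨⟨x, y⟩, ⟨x', y'⟩⟩ ht heq
      simp only [mem_product] at ht heq ⊢
      exact ⟨⟨⟨ht.1.1, ht.2.1⟩, ht.1.2, ht.2.2⟩, by linarith⟩
    · simp only [Prod.mk.injEq] at h
      exact Prod.ext (Prod.ext h.1.1 h.2.1) (Prod.ext h.1.2 h.2.2)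
  -- self-coincidences of differences are additive quadruples
  have h2 : ∀ (c : ℕ) (B : Finset (Fin d → ℕ)),
      coinc (B ×ˢ B) (B ×ˢ B) (fun p => vals c p.1 - vals c p.2) (fun p => vals c p.1 - vals c p.2) ≤
        coinc (B ×ˢ B) (B ×ˢ B) (fun p => vals c p.1 + vals c p.2) (fun p => vals c p.1 + vals c p.2) := by
    intro c B
    refine coinc_le_coinc_of_injOn (fun t => ((t.1.1, t.2.2), (t.2.1, t.1.2)))
      ?_ (fun t _ t' _ h => ?_)
    · rintro ⟨⟨x, x'⟩, ⟨x'', x'''⟩⟩ ht heq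
      simp only [mem_product] at ht heq ⊢
      exact ⟨⟨⟨ht.1.1, ht.2.2⟩, ht.2.1, ht.1.2⟩, by linarith⟩
    · simp only [Prod.mk.injEq] at h
      exact Prod.ext (Prod.ext h.1.1 h.2.2) (Prod.ext h.2.1 h.1.2)
  have h2' : ∀ (c : ℕ) (B : Finset (Fin d → ℕ)),
      coinc (B ×ˢ B) (B ×ˢ B) (fun p => vals c p.2 - vals c p.1) (fun p => vals c p.2 - vals c p.1) ≤
        coinc (B ×ˢ B) (B ×ˢ B) (fun p => vals c p.1 + vals c p.2) (fun p => vals c p.1 + vals c p.2) := by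
    intro c B
    refine coinc_le_coinc_of_injOn (fun t => ((t.1.2, t.2.1), (t.2.2, t.1.1)))
      ?_ (fun t _ t' _ h => ?_)
    · rintro ⟨⟨x, x'⟩, ⟨x'', x'''⟩⟩ ht heq
      simp only [mem_product] at ht heq ⊢
      exact ⟨⟨⟨ht.1.2, ht.2.1⟩, ht.2.2, ht.1.1⟩, by linarith⟩
    · simp only [Prod.mk.injEq] at h
      exact Prod.ext (Prod.ext h.2.2 h.1.1) (Prod.ext h.1.2 h.2.1)
  calc mixedEnergy c₁ X c₂ Y ^ 2
      ≤ coinc (BX ×ˢ BX) (BY ×ˢ BY) (fun p => vals c₁ p.1 - vals c₁ p.2)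
          (fun p => vals c₂ p.2 - vals c₂ p.1) ^ 2 := Nat.pow_le_pow_left h1 2
    _ ≤ _ := coinc_sq_le _ _ _ _
    _ ≤ energy4 c₁ X * energy4 c₂ Y := Nat.mul_le_mul (h2 c₁ BX) (h2' c₂ BY)

/-! ### The second moment: representation numbers and the divisor bound -/

/-- A tuple in a box with `∏ xᵢ^{i+1} = m` has all coordinates among the divisors of `m`, so
there are at most `τ(m)^d` of them (`m ≠ 0`). [folklore] -/
theorem card_filter_shapeVal_eq_le {d : ℕ} (B : Finset (Fin d → ℕ)) {m : ℕ} (hm : m ≠ 0) :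
    (B.filter (fun x => shapeVal x = m)).card ≤ m.divisors.card ^ d := by
  classical
  calc (B.filter (fun x => shapeVal x = m)).card
      ≤ (Fintype.piFinset fun _ : Fin d => m.divisors).card := by
        refine card_le_card fun x hx => ?_
        obtain ⟨-, hxm⟩ := mem_filter.mp hx
        refine Fintype.mem_piFinset.mpr fun i => Nat.mem_divisors.mpr ⟨?_, hm⟩
        rw [← hxm, shapeVal]
        exact (dvd_pow_self (x i) (Nat.succ_ne_zero _)).trans
          (dvd_prod_of_mem (fun i => x i ^ ((i : ℕ) + 1)) (mem_univ i))
    _ = m.divisors.card ^ d := by rw [Fintype.card_piFinset, prod_const, card_univ, Fintype.card_fin]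

/-- **Second moment bound** ("Parseval and the divisor bound", [Bernert2025, (3.1)]): if
`c ≥ 1` and `τ(∏ zᵢ^{i+1}) ≤ D` for every `z` in the box, then `E₂ ≤ #box · D^d`.
[cite: Bernert2025, Proposition 3] -/
theorem energy2_le {d : ℕ} {c : ℕ} (hc : 0 < c) (X : Fin d → ℕ) {D : ℕ}
    (hD : ∀ z ∈ dyadicBox X, (shapeVal z).divisors.card ≤ D)
    (hpos : ∀ z ∈ dyadicBox X, shapeVal z ≠ 0) :
    energy2 c X ≤ (dyadicBox X).card * D ^ d := by
  classical
  rw [energy2, coinc, card_eq_sum_card_fiberwise (f := Prod.fst) (t := dyadicBox X) (fun t ht => by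
    exact mem_coe.mpr (mem_product.mp (mem_filter.mp (mem_coe.mp ht)).1).1)]
  calc ∑ z ∈ dyadicBox X, (((dyadicBox X ×ˢ dyadicBox X).filter
        (fun t => vals c t.1 = vals c t.2)).filter (fun t => t.1 = z)).card
      ≤ ∑ z ∈ dyadicBox X, D ^ d := by
        refine sum_le_sum fun z hz => ?_
        calc _ ≤ ((dyadicBox X).filter (fun z' => shapeVal z' = shapeVal z)).card := by
              refine card_le_card_of_injOn Prod.snd (fun t ht => ?_) (fun t ht t' ht' h => ?_)
              · obtain ⟨ht1, ht2⟩ := mem_filter.mp (mem_coe.mp ht)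
                obtain ⟨hbox, heq⟩ := mem_filter.mp ht1
                refine mem_coe.mpr (mem_filter.mpr ⟨(mem_product.mp hbox).2, ?_⟩)
                simp only [vals, Nat.cast_inj] at heq
                rw [← ht2]
                exact (Nat.eq_of_mul_eq_mul_left hc heq).symm
              · have h1 := (mem_filter.mp (mem_coe.mp ht)).2
                have h2 := (mem_filter.mp (mem_coe.mp ht')).2
                exact Prod.ext (h1.trans h2.symm) h
          _ ≤ (shapeVal z).divisors.card ^ d := card_filter_shapeVal_eq_le _ (hpos z hz)
          _ ≤ D ^ d := Nat.pow_le_pow_left (hD z hz) d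
    _ = (dyadicBox X).card * D ^ d := by rw [sum_const, smul_eq_mul]

end AbcShapes

end Literature.NumberTheory.DiophantineGeometry
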